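import Mathlib.Data.Nat.Choose.Central
import Mathlib.Tactic
import Literature.NumberTheory.Transcendental.PeriodsWave0
import HarnessLib

/-!
# Zudilin 2002: a third-order Apéry-like recursion for `ζ(5)` — the recursion and Theorem 1

Source: W. Zudilin, *A third-order Apéry-like recursion for ζ(5)*, Mat. Zametki 72:5 (2002) 796–800
(= Math. Notes 72 (2002) 733–737), arXiv:math/0206178 [Zudilin2002Zeta5].

HONEST FRAMING (cell `pub-zeta5`): systematic search; no irrationality claim unless certified. This file
types PUBLISHED data and statements only:

* the difference equation (1) with its polynomial coefficients `a₀, a₁, a₂` (`IsSolution`, as printed);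
* its three solutions `q, p, ptilde` fixed by the printed initial data
  `q₀ = -1, q₁ = 42, q₂ = -17934`, `p₀ = 0, p₁ = 87/2, p₂ = -1190161/64`,
  `p̃₀ = 0, p̃₁ = 101/2, p̃₂ = -344923/16` (defined through the elementary third-order solver `rec3`,
  legitimate because the leading coefficient `(n+1)⁶ a₀(n)` never vanishes for `n ≥ 1`, `lead_ne_zero`);
* the linear forms `ℓ_n = q_n ζ(5) - p_n`, `ℓ̃_n = q_n ζ(3) - p̃_n` of (2), with `ζ(k) = zetaValue k`;
* **Theorem 1** as NAMED FACTS (not proved here): the signs (3) `theorem1_signs`, and the rates (4)–(5)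
  `theorem1_rates` — `lim log|ℓ_n|/n = lim log|ℓ̃_n|/n = log μ₂`, `lim log|q_n|/n = … = log|μ₃|`, where
  `μ₁ = -0.02001512…, μ₂ = 0.33753726…, μ₃ = -2368.31752213…` are the roots of the characteristic
  polynomial `μ³ + 2368μ² - 752μ - 16` (`charPoly`); the roots are pinned by rational brackets.

NOT here: display (6) of the paper (`q_n ∈ ℤ, 2D_n⁵ p_n ∈ ℤ, 2D_n³ p̃_n ∈ ℤ`), which the source states
as the outcome of calculations, not as a theorem — the cell checks such inclusions by kernel computation
under `Summits/KontsevichZagierPeriods/Zeta5Search/`; the hypergeometric construction of Sect. 2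
(series (7), recursions (8)–(9), Theorems 2–3, inclusions (14)) is not typed in this file.
-/

noncomputable section

open Filter Set
open scoped Topology

namespace Literature.NumberTheory.Irrationality.Zudilin2002

/-! ### An elementary third-order solver -/

/-- State `(x_m, x_{m+1}, x_{m+2})` of the sequence with initial values `x₀, x₁, x₂` and step map
`next m x_m x_{m+1} x_{m+2} = x_{m+3}`. Computable structural recursion. [folklore] -/
def rec3Aux (next : ℕ → ℚ → ℚ → ℚ → ℚ) (x₀ x₁ x₂ : ℚ) : ℕ → ℚ × ℚ × ℚ
  | 0 => (x₀, x₁, x₂)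
  | m + 1 =>
    let t := rec3Aux next x₀ x₁ x₂ m
    (t.2.1, t.2.2, next m t.1 t.2.1 t.2.2)

/-- The sequence with initial values `x₀, x₁, x₂` and `x_{m+3} = next m x_m x_{m+1} x_{m+2}`. [folklore] -/
def rec3 (next : ℕ → ℚ → ℚ → ℚ → ℚ) (x₀ x₁ x₂ : ℚ) (n : ℕ) : ℚ := (rec3Aux next x₀ x₁ x₂ n).1

/-- `rec3 … 0 = x₀`. [folklore] -/
@[simp] theorem rec3_zero (next : ℕ → ℚ → ℚ → ℚ → ℚ) (x₀ x₁ x₂ : ℚ) : rec3 next x₀ x₁ x₂ 0 = x₀ := rfl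
/-- `rec3 … 1 = x₁`. [folklore] -/
@[simp] theorem rec3_one (next : ℕ → ℚ → ℚ → ℚ → ℚ) (x₀ x₁ x₂ : ℚ) : rec3 next x₀ x₁ x₂ 1 = x₁ := rfl
/-- `rec3 … 2 = x₂`. [folklore] -/
@[simp] theorem rec3_two (next : ℕ → ℚ → ℚ → ℚ → ℚ) (x₀ x₁ x₂ : ℚ) : rec3 next x₀ x₁ x₂ 2 = x₂ := rfl

/-- `x_{m+1}` is the middle component of the state at `m` (definitional). [folklore] -/
theorem rec3_succ_eq (next : ℕ → ℚ → ℚ → ℚ → ℚ) (x₀ x₁ x₂ : ℚ) (m : ℕ) :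
    rec3 next x₀ x₁ x₂ (m + 1) = (rec3Aux next x₀ x₁ x₂ m).2.1 := rfl

/-- `x_{m+2}` is the last component of the state at `m` (definitional). [folklore] -/
theorem rec3_succ_succ_eq (next : ℕ → ℚ → ℚ → ℚ → ℚ) (x₀ x₁ x₂ : ℚ) (m : ℕ) :
    rec3 next x₀ x₁ x₂ (m + 2) = (rec3Aux next x₀ x₁ x₂ m).2.2 := rfl

/-- The defining step `x_{m+3} = next m x_m x_{m+1} x_{m+2}`. [folklore] -/
theorem rec3_step (next : ℕ → ℚ → ℚ → ℚ → ℚ) (x₀ x₁ x₂ : ℚ) (m : ℕ) :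
    rec3 next x₀ x₁ x₂ (m + 3) =
      next m (rec3 next x₀ x₁ x₂ m) (rec3 next x₀ x₁ x₂ (m + 1)) (rec3 next x₀ x₁ x₂ (m + 2)) := by
  rw [rec3_succ_succ_eq, rec3_succ_eq]
  rfl

/-! ### The recursion (1) -/

/-- `a₀(n) = 41218n³ - 48459n² + 20010n - 2871`. [cite: Zudilin2002Zeta5, Sect. 1, eq. (1)] -/
def a₀ {R : Type*} [CommRing R] (n : R) : R := 41218 * n ^ 3 - 48459 * n ^ 2 + 20010 * n - 2871

/-- `a₁(n) = 2(48802112n⁹ + 89030880n⁸ + 36002654n⁷ - 24317344n⁶ - 19538418n⁵ + 1311365n⁴ + 3790503n³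
  + 460056n² - 271701n - 60291)`. [cite: Zudilin2002Zeta5, Sect. 1, eq. (1)] -/
def a₁ {R : Type*} [CommRing R] (n : R) : R :=
  2 * (48802112 * n ^ 9 + 89030880 * n ^ 8 + 36002654 * n ^ 7 - 24317344 * n ^ 6 - 19538418 * n ^ 5
    + 1311365 * n ^ 4 + 3790503 * n ^ 3 + 460056 * n ^ 2 - 271701 * n - 60291)

/-- `a₂(n) = 3874492n⁸ - 2617900n⁷ - 3144314n⁶ + 2947148n⁵ + 647130n⁴ - 1182926n³ + 115771n² + 170716n
  - 44541`. [cite: Zudilin2002Zeta5, Sect. 1, eq. (1)] -/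
def a₂ {R : Type*} [CommRing R] (n : R) : R :=
  3874492 * n ^ 8 - 2617900 * n ^ 7 - 3144314 * n ^ 6 + 2947148 * n ^ 5 + 647130 * n ^ 4
    - 1182926 * n ^ 3 + 115771 * n ^ 2 + 170716 * n - 44541

/-- A sequence `y : ℕ → ℚ` solves the difference equation (1):
`(n+1)⁶ a₀(n) y_{n+1} + a₁(n) y_n - 4(2n-1) a₂(n) y_{n-1} - 4(n-1)⁴(2n-1)(2n-3) a₀(n+1) y_{n-2} = 0`
for all `n ≥ 2` (the range on which all four indices are meaningful). [cite: Zudilin2002Zeta5, Sect. 1, eq. (1)] -/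
def IsSolution (y : ℕ → ℚ) : Prop :=
  ∀ n : ℕ, 2 ≤ n →
    ((n : ℚ) + 1) ^ 6 * a₀ (n : ℚ) * y (n + 1) + a₁ (n : ℚ) * y n
      - 4 * (2 * (n : ℚ) - 1) * a₂ (n : ℚ) * y (n - 1)
      - 4 * ((n : ℚ) - 1) ^ 4 * (2 * (n : ℚ) - 1) * (2 * (n : ℚ) - 3) * a₀ ((n : ℚ) + 1) * y (n - 2) = 0

/-- `a₀(n) > 0` for integers `n ≥ 1` (`a₀(1) = 9898`; for `n ≥ 2`, `n²(41218n - 48459) + 20010n - 2871 > 0`).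
[cite: Zudilin2002Zeta5, Sect. 1, eq. (1)] -/
theorem a₀_pos {n : ℤ} (hn : 1 ≤ n) : 0 < a₀ n := by
  unfold a₀
  rcases eq_or_lt_of_le hn with rfl | h2
  · norm_num
  · nlinarith [mul_pos (by linarith : (0:ℤ) < n) (by linarith : (0:ℤ) < n),
      mul_pos (mul_pos (by linarith : (0:ℤ) < n) (by linarith : (0:ℤ) < n)) (by linarith : (0:ℤ) < n - 1)]

/-- The leading coefficient `(n+1)⁶ a₀(n)` of (1) is nonzero for natural `n ≥ 1`, so (1) determines
`y_{n+1}` from `y_n, y_{n-1}, y_{n-2}`. [cite: Zudilin2002Zeta5, Sect. 1, eq. (1)] -/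
theorem lead_ne_zero {n : ℕ} (hn : 1 ≤ n) : ((n : ℚ) + 1) ^ 6 * a₀ (n : ℚ) ≠ 0 := by
  have h := a₀_pos (n := (n : ℤ)) (by exact_mod_cast hn)
  have hc : ((a₀ (n : ℤ) : ℤ) : ℚ) = a₀ (n : ℚ) := by simp [a₀]
  have h1 : a₀ (n : ℚ) ≠ 0 := by rw [← hc]; exact Int.cast_ne_zero.mpr h.ne'
  have h2 : ((n : ℚ) + 1) ^ 6 ≠ 0 := by positivity
  exact mul_ne_zero h2 h1

/-- The step map of (1): at `n = m + 2`,
`y_{m+3} = -(a₁(n) y_n - 4(2n-1)a₂(n) y_{n-1} - 4(n-1)⁴(2n-1)(2n-3)a₀(n+1) y_{n-2}) / ((n+1)⁶ a₀(n))`.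
[cite: Zudilin2002Zeta5, Sect. 1, eq. (1)] -/
def step (m : ℕ) (y₀ y₁ y₂ : ℚ) : ℚ :=
  -(a₁ ((m : ℚ) + 2) * y₂ - 4 * (2 * ((m : ℚ) + 2) - 1) * a₂ ((m : ℚ) + 2) * y₁
      - 4 * ((m : ℚ) + 2 - 1) ^ 4 * (2 * ((m : ℚ) + 2) - 1) * (2 * ((m : ℚ) + 2) - 3)
        * a₀ ((m : ℚ) + 2 + 1) * y₀)
    / (((m : ℚ) + 2 + 1) ^ 6 * a₀ ((m : ℚ) + 2))

/-- The step map does solve (1) at index `n = m + 2` (clearing the nonzero leading coefficient).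
[cite: Zudilin2002Zeta5, Sect. 1, eq. (1)] -/
theorem step_spec (m : ℕ) (y₀ y₁ y₂ : ℚ) :
    ((m : ℚ) + 2 + 1) ^ 6 * a₀ ((m : ℚ) + 2) * step m y₀ y₁ y₂ + a₁ ((m : ℚ) + 2) * y₂
      - 4 * (2 * ((m : ℚ) + 2) - 1) * a₂ ((m : ℚ) + 2) * y₁
      - 4 * ((m : ℚ) + 2 - 1) ^ 4 * (2 * ((m : ℚ) + 2) - 1) * (2 * ((m : ℚ) + 2) - 3)
        * a₀ ((m : ℚ) + 2 + 1) * y₀ = 0 := by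
  have hc := lead_ne_zero (n := m + 2) (by omega)
  push_cast at hc
  unfold step
  rw [mul_div_assoc', mul_div_cancel_left₀ _ hc]
  ring

/-- The solution of (1) with initial data `y₀, y₁, y₂`. [cite: Zudilin2002Zeta5, Sect. 1] -/
def sol (y₀ y₁ y₂ : ℚ) : ℕ → ℚ := rec3 step y₀ y₁ y₂

/-- `sol y₀ y₁ y₂` solves (1). [cite: Zudilin2002Zeta5, Sect. 1, eq. (1)] -/
theorem sol_isSolution (y₀ y₁ y₂ : ℚ) : IsSolution (sol y₀ y₁ y₂) := by
  intro n hn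
  obtain ⟨m, rfl⟩ : ∃ m, n = m + 2 := ⟨n - 2, by omega⟩
  simp only [Nat.add_sub_cancel, show m + 2 - 1 = m + 1 by omega, show m + 2 + 1 = m + 3 by omega]
  push_cast
  unfold sol
  rw [rec3_step]
  linear_combination
    step_spec m (rec3 step y₀ y₁ y₂ m) (rec3 step y₀ y₁ y₂ (m + 1)) (rec3 step y₀ y₁ y₂ (m + 2))

/-- Uniqueness for (1): two solutions with the same `y₀, y₁, y₂` coincide. [cite: Zudilin2002Zeta5, Sect. 1] -/
theorem IsSolution.ext_of_init {x y : ℕ → ℚ} (hx : IsSolution x) (hy : IsSolution y)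
    (h0 : x 0 = y 0) (h1 : x 1 = y 1) (h2 : x 2 = y 2) : x = y := by
  funext n
  induction n using Nat.strong_induction_on with
  | _ n ih =>
    rcases n with _ | _ | _ | m
    · exact h0
    · exact h1
    · exact h2
    · have ex := hx (m + 2) (by omega)
      have ey := hy (m + 2) (by omega)
      have hc := lead_ne_zero (n := m + 2) (by omega)
      simp only [show m + 2 + 1 = m + 1 + 1 + 1 by omega, show m + 2 - 1 = m + 1 by omega,
        Nat.add_sub_cancel] at ex ey
      rw [ih (m + 2) (by omega), ih (m + 1) (by omega), ih m (by omega)] at ex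
      have : (((m + 2 : ℕ) : ℚ) + 1) ^ 6 * a₀ (((m + 2 : ℕ) : ℚ)) * (x (m + 1 + 1 + 1) - y (m + 1 + 1 + 1))
          = 0 := by
        linear_combination ex - ey
      rcases mul_eq_zero.mp this with h | h
      · exact absurd h hc
      · linarith

/-! ### The three printed solutions and the linear forms (2) -/

/-- `q_n`: the solution of (1) with `q₀ = -1, q₁ = 42, q₂ = -17934`. [cite: Zudilin2002Zeta5, Sect. 1] -/
def q : ℕ → ℚ := sol (-1) 42 (-17934)

/-- `p_n`: the solution of (1) with `p₀ = 0, p₁ = 87/2, p₂ = -1190161/64`. [cite: Zudilin2002Zeta5, Sect. 1] -/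
def p : ℕ → ℚ := sol 0 (87 / 2) (-1190161 / 64)

/-- `p̃_n`: the solution of (1) with `p̃₀ = 0, p̃₁ = 101/2, p̃₂ = -344923/16`. [cite: Zudilin2002Zeta5, Sect. 1] -/
def ptilde : ℕ → ℚ := sol 0 (101 / 2) (-344923 / 16)

/-- The linear form `ℓ_n = q_n ζ(5) - p_n` of (2). [cite: Zudilin2002Zeta5, Sect. 1, eq. (2)] -/
def ell (n : ℕ) : ℝ := (q n : ℝ) * Literature.NumberTheory.Transcendental.zetaValue 5 - (p n : ℝ)

/-- The linear form `ℓ̃_n = q_n ζ(3) - p̃_n` of (2). [cite: Zudilin2002Zeta5, Sect. 1, eq. (2)] -/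
def ellTilde (n : ℕ) : ℝ :=
  (q n : ℝ) * Literature.NumberTheory.Transcendental.zetaValue 3 - (ptilde n : ℝ)

/-! ### The characteristic polynomial and Theorem 1 (named facts) -/

/-- The characteristic polynomial `μ³ + 2368μ² - 752μ - 16` of (1), eq. (5). [cite: Zudilin2002Zeta5, Sect. 1, eq. (5)] -/
def charPoly {R : Type*} [CommRing R] (μ : R) : R := μ ^ 3 + 2368 * μ ^ 2 - 752 * μ - 16

/-- Rational brackets for the three roots `μ₁ = -0.02001512…`, `μ₂ = 0.33753726…`, `μ₃ = -2368.31752213…`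
of (5): sign changes of `charPoly` (exact arithmetic). [cite: Zudilin2002Zeta5, Sect. 1, eq. (5)] -/
theorem charPoly_brackets :
    0 < charPoly (-2001513 / 10 ^ 8 : ℚ) ∧ charPoly (-2001512 / 10 ^ 8 : ℚ) < 0
    ∧ charPoly (33753726 / 10 ^ 8 : ℚ) < 0 ∧ 0 < charPoly (33753727 / 10 ^ 8 : ℚ)
    ∧ charPoly (-236831752214 / 10 ^ 8 : ℚ) < 0 ∧ 0 < charPoly (-236831752213 / 10 ^ 8 : ℚ) := by
  unfold charPoly; norm_num

/-- **Theorem 1, signs (3)** (named fact, not proved here): `ℓ_n > 0` and `ℓ̃_n < 0` for all `n ≥ 1`.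
[cite: Zudilin2002Zeta5, Theorem 1, eq. (3)] -/
def theorem1_signs : Prop := ∀ n : ℕ, 1 ≤ n → 0 < ell n ∧ ellTilde n < 0

/-- **Theorem 1, rates (4)–(5)** (named fact, not proved here): with `μ₂ ∈ (0.33753726, 0.33753727)` and
`μ₃ ∈ (-2368.31752214, -2368.31752213)` the roots of `μ³ + 2368μ² - 752μ - 16` in those brackets,
`log|ℓ_n|/n → log μ₂`, `log|ℓ̃_n|/n → log μ₂`, and `log|q_n|/n, log|p_n|/n, log|p̃_n|/n → log|μ₃|`.
[cite: Zudilin2002Zeta5, Theorem 1, eqs. (4)–(5)] -/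
def theorem1_rates : Prop :=
  ∃ μ₂ μ₃ : ℝ, charPoly μ₂ = 0 ∧ μ₂ ∈ Ioo (33753726 / 10 ^ 8 : ℝ) (33753727 / 10 ^ 8)
    ∧ charPoly μ₃ = 0 ∧ μ₃ ∈ Ioo (-236831752214 / 10 ^ 8 : ℝ) (-236831752213 / 10 ^ 8)
    ∧ Tendsto (fun n : ℕ => Real.log |ell n| / n) atTop (𝓝 (Real.log μ₂))
    ∧ Tendsto (fun n : ℕ => Real.log |ellTilde n| / n) atTop (𝓝 (Real.log μ₂))
    ∧ Tendsto (fun n : ℕ => Real.log |(q n : ℝ)| / n) atTop (𝓝 (Real.log |μ₃|))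
    ∧ Tendsto (fun n : ℕ => Real.log |(p n : ℝ)| / n) atTop (𝓝 (Real.log |μ₃|))
    ∧ Tendsto (fun n : ℕ => Real.log |(ptilde n : ℝ)| / n) atTop (𝓝 (Real.log |μ₃|))

/-- The two brackets of `theorem1_rates` do contain roots of the characteristic polynomial
(intermediate value theorem; this part is PROVED). [cite: Zudilin2002Zeta5, Sect. 1, eq. (5)] -/
theorem charPoly_roots :
    (∃ μ : ℝ, μ ∈ Ioo (33753726 / 10 ^ 8 : ℝ) (33753727 / 10 ^ 8) ∧ charPoly μ = 0)
    ∧ (∃ μ : ℝ, μ ∈ Ioo (-236831752214 / 10 ^ 8 : ℝ) (-236831752213 / 10 ^ 8) ∧ charPoly μ = 0) := by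
  have hcont : Continuous (fun x : ℝ => charPoly x) := by unfold charPoly; fun_prop
  refine ⟨?_, ?_⟩
  · have hab : (33753726 / 10 ^ 8 : ℝ) ≤ 33753727 / 10 ^ 8 := by norm_num
    have ha : charPoly (33753726 / 10 ^ 8 : ℝ) < 0 := by unfold charPoly; norm_num
    have hb : (0 : ℝ) < charPoly (33753727 / 10 ^ 8 : ℝ) := by unfold charPoly; norm_num
    obtain ⟨x, hx, hx0⟩ := intermediate_value_Ioo hab hcont.continuousOn ⟨ha, hb⟩
    exact ⟨x, hx, hx0⟩
  · have hab : (-236831752214 / 10 ^ 8 : ℝ) ≤ -236831752213 / 10 ^ 8 := by norm_num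
    have ha : charPoly (-236831752214 / 10 ^ 8 : ℝ) < 0 := by unfold charPoly; norm_num
    have hb : (0 : ℝ) < charPoly (-236831752213 / 10 ^ 8 : ℝ) := by unfold charPoly; norm_num
    obtain ⟨x, hx, hx0⟩ := intermediate_value_Ioo hab hcont.continuousOn ⟨ha, hb⟩
    exact ⟨x, hx, hx0⟩

end Literature.NumberTheory.Irrationality.Zudilin2002
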